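import Mathlib
import Summits.Ventures.PercRepro2.HMFLeafInvisible

/-!
# The series reduction of the mean field at an unmarked vertex of degree two (blind cell PercRepro2,
night-1 g15; NIGHT1-G15.md §2)

Let `v` carry exactly the two edges `f = {v, w}` and `f' = {v, w'}` (`hdeg`), and let `v` be none of
the marks.  The *collapse* `collapse f f' ω := ω[f ↦ ω f && ω f', f' ↦ true]` pushes the product law
`p` forward to the law `p[f ↦ p f · p f', f' ↦ 1]` (`expect_collapse`, `prob_collapse`), and the
connections among the vertices other than `v` see the pair `(ω f, ω f')` only through its
conjunction (`conn_of_conn_of_eq_off_pair`, a closure argument), so every marked connection event,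
every residual event of `X̂` and the residual term of the cluster of `a₃` are collapse-invariant
(`preimage_connEvent_collapse`, `preimage_connDelEvent_collapse`, `connDelEvent_insert_pair`).
The mean-field consequences — `termW_collapse`, `Xhat_series` and **`HMFc_series`** — are in
`SeriesHMF`.  Exact twin `mining/night-1/g15/series_check.py` (150 / 150 random instances `n ≤ 7`,
`m ≤ 10`; the planted control at a degree-3 vertex fires).
-/

open scoped Classical

namespace Summit.Ventures.PercRepro2

open UnionCluster CovForm PendantRoot

namespace SeriesCollapse

section Graph

variable {V : Type*} {E : Type*} {ends : E → Sym2 V} {v w w' : V} {f f' : E}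

/-- **The closure argument.** If `ω₁, ω₂` agree off `{f, f'}` and `ω₁ f && ω₁ f' = ω₂ f && ω₂ f'`,
a connection from `x ≠ v` in `ω₁` lands at `y ≠ v` with `x ↔ y` in `ω₂`, or at `v` through one of its
two edges (open in `ω₁`) with the far end reached in `ω₂`. -/
lemma conn_pair_aux {ω₁ ω₂ : Config E} (hf : ends f = s(v, w)) (hf' : ends f' = s(v, w'))
    (hdeg : ∀ e, v ∈ ends e → e = f ∨ e = f') (hvw : v ≠ w) (hvw' : v ≠ w')
    (hagree : ∀ e, e ≠ f → e ≠ f' → ω₁ e = ω₂ e) (hand : (ω₁ f && ω₁ f') = (ω₂ f && ω₂ f'))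
    {x y : V} (hx : x ≠ v) (h : Conn ends ω₁ x y) :
    (y ≠ v ∧ Conn ends ω₂ x y) ∨
      (y = v ∧ ((ω₁ f = true ∧ Conn ends ω₂ x w) ∨ (ω₁ f' = true ∧ Conn ends ω₂ x w'))) := by
  let S : Set V := {z | (z ≠ v ∧ Conn ends ω₂ x z) ∨
    (z = v ∧ ((ω₁ f = true ∧ Conn ends ω₂ x w) ∨ (ω₁ f' = true ∧ Conn ends ω₂ x w')))}
  have hS : ∀ z ∈ S, ∀ z', (openGraph ends ω₁).Adj z z' → z' ∈ S := by
    intro z hz z' hzz'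
    obtain ⟨hne, e, he, hends⟩ := openGraph_adj.1 hzz'
    by_cases hz'v : z' = v
    · -- the edge enters `v`: it is `f` or `f'`, and `z` is its far end
      have hev : v ∈ ends e := by rw [hends, ← hz'v]; exact Sym2.mem_mk_right z z'
      have hzS : z ≠ v ∧ Conn ends ω₂ x z := by
        rcases hz with hz | ⟨hzv, _⟩
        · exact hz
        · exact absurd (hzv.trans hz'v.symm) hne
      rcases hdeg e hev with hef | hef
      · rw [hef] at he hends
        have hzw : z = w := by
          rw [hf, hz'v, Sym2.eq_iff] at hends
          rcases hends with ⟨h1, _⟩ | ⟨_, h2⟩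
          · exact absurd h1.symm hzS.1
          · exact h2.symm
        exact Or.inr ⟨hz'v, Or.inl ⟨he, hzw ▸ hzS.2⟩⟩
      · rw [hef] at he hends
        have hzw : z = w' := by
          rw [hf', hz'v, Sym2.eq_iff] at hends
          rcases hends with ⟨h1, _⟩ | ⟨_, h2⟩
          · exact absurd h1.symm hzS.1
          · exact h2.symm
        exact Or.inr ⟨hz'v, Or.inr ⟨he, hzw ▸ hzS.2⟩⟩
    · by_cases hzv : z = v
      · -- the edge leaves `v`
        have hev : v ∈ ends e := by rw [hends, hzv]; exact Sym2.mem_mk_left v z'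
        have hvS : (ω₁ f = true ∧ Conn ends ω₂ x w) ∨ (ω₁ f' = true ∧ Conn ends ω₂ x w') := by
          rcases hz with ⟨hzv', _⟩ | ⟨_, h⟩
          · exact absurd hzv hzv'
          · exact h
        rcases hdeg e hev with hef | hef
        · rw [hef] at he hends
          have hz'w : z' = w := by
            rw [hf, hzv, Sym2.eq_iff] at hends
            rcases hends with ⟨_, h2⟩ | ⟨_, h2⟩
            · exact h2.symm
            · exact absurd h2.symm hvw
          refine Or.inl ⟨hz'v, ?_⟩
          rw [hz'w]
          rcases hvS with ⟨_, hw⟩ | ⟨hf'1, hw'⟩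
          · exact hw
          · have h2 : (ω₂ f && ω₂ f') = true := by rw [← hand, he, hf'1]; rfl
            rw [Bool.and_eq_true] at h2
            exact conn_trans (conn_trans hw' (conn_of_openAdj ⟨f', h2.2, by rw [hf', Sym2.eq_swap]⟩))
              (conn_of_openAdj ⟨f, h2.1, hf⟩)
        · rw [hef] at he hends
          have hz'w : z' = w' := by
            rw [hf', hzv, Sym2.eq_iff] at hends
            rcases hends with ⟨_, h2⟩ | ⟨_, h2⟩
            · exact h2.symm
            · exact absurd h2.symm hvw'
          refine Or.inl ⟨hz'v, ?_⟩
          rw [hz'w]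
          rcases hvS with ⟨hf1, hw⟩ | ⟨_, hw'⟩
          · have h2 : (ω₂ f && ω₂ f') = true := by rw [← hand, hf1, he]; rfl
            rw [Bool.and_eq_true] at h2
            exact conn_trans (conn_trans hw (conn_of_openAdj ⟨f, h2.1, by rw [hf, Sym2.eq_swap]⟩))
              (conn_of_openAdj ⟨f', h2.2, hf'⟩)
          · exact hw'
      · -- neither end is `v`: the edge is neither `f` nor `f'`, and it is open in `ω₂` too
        have hzS : Conn ends ω₂ x z := by
          rcases hz with ⟨_, h⟩ | ⟨hzv', _⟩
          · exact h
          · exact absurd hzv' hzv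
        have hef : e ≠ f := by
          rintro rfl
          rw [hf, Sym2.eq_iff] at hends
          rcases hends with ⟨h1, _⟩ | ⟨h1, _⟩
          · exact hzv h1.symm
          · exact hz'v h1.symm
        have hef' : e ≠ f' := by
          rintro rfl
          rw [hf', Sym2.eq_iff] at hends
          rcases hends with ⟨h1, _⟩ | ⟨h1, _⟩
          · exact hzv h1.symm
          · exact hz'v h1.symm
        have he2 : ω₂ e = true := by rw [← hagree e hef hef']; exact he
        exact Or.inl ⟨hz'v, conn_trans hzS (conn_of_openAdj ⟨e, he2, hends⟩)⟩
  have hxS : x ∈ S := Or.inl ⟨hx, conn_refl ends ω₂ x⟩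
  exact mem_of_conn_of_closed hS hxS h

/-- **Connections among the vertices other than `v` see `(ω f, ω f')` only through `ω f && ω f'`.** -/
lemma conn_of_conn_of_eq_off_pair {ω₁ ω₂ : Config E} (hf : ends f = s(v, w))
    (hf' : ends f' = s(v, w')) (hdeg : ∀ e, v ∈ ends e → e = f ∨ e = f') (hvw : v ≠ w) (hvw' : v ≠ w')
    (hagree : ∀ e, e ≠ f → e ≠ f' → ω₁ e = ω₂ e) (hand : (ω₁ f && ω₁ f') = (ω₂ f && ω₂ f'))
    {x y : V} (hx : x ≠ v) (hy : y ≠ v) (h : Conn ends ω₁ x y) : Conn ends ω₂ x y := by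
  rcases conn_pair_aux hf hf' hdeg hvw hvw' hagree hand hx h with ⟨_, h⟩ | ⟨hyv, _⟩
  · exact h
  · exact absurd hyv hy

/-- The two-sided form of `conn_of_conn_of_eq_off_pair`. -/
lemma conn_pair_iff {ω₁ ω₂ : Config E} (hf : ends f = s(v, w)) (hf' : ends f' = s(v, w'))
    (hdeg : ∀ e, v ∈ ends e → e = f ∨ e = f') (hvw : v ≠ w) (hvw' : v ≠ w')
    (hagree : ∀ e, e ≠ f → e ≠ f' → ω₁ e = ω₂ e) (hand : (ω₁ f && ω₁ f') = (ω₂ f && ω₂ f'))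
    {x y : V} (hx : x ≠ v) (hy : y ≠ v) : Conn ends ω₁ x y ↔ Conn ends ω₂ x y :=
  ⟨conn_of_conn_of_eq_off_pair hf hf' hdeg hvw hvw' hagree hand hx hy,
    conn_of_conn_of_eq_off_pair hf hf' hdeg hvw hvw' (fun e h1 h2 => (hagree e h1 h2).symm)
      hand.symm hx hy⟩

/-- A connection from `x ≠ v` to `v` enters `v` through `f` (from `w`) or through `f'` (from `w'`). -/
lemma conn_to_pair {ω : Config E} (hf : ends f = s(v, w)) (hf' : ends f' = s(v, w'))
    (hdeg : ∀ e, v ∈ ends e → e = f ∨ e = f') (hvw : v ≠ w) (hvw' : v ≠ w') {x : V} (hx : x ≠ v)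
    (h : Conn ends ω x v) : (ω f = true ∧ Conn ends ω x w) ∨ (ω f' = true ∧ Conn ends ω x w') := by
  rcases conn_pair_aux (ω₁ := ω) (ω₂ := ω) hf hf' hdeg hvw hvw' (fun _ _ _ => rfl) rfl hx h with
    ⟨hne, _⟩ | ⟨_, h⟩
  · exact absurd rfl hne
  · exact h

end Graph

section Collapse

variable {V : Type*} {E : Type*} [DecidableEq E] {ends : E → Sym2 V} {v w w' : V} {f f' : E}

/-- **The collapse of the pair `{f, f'}`**: `f` takes the conjunction `ω f && ω f'`, `f'` is forced
open.  Under the product law this realises the weights `p[f ↦ p f · p f', f' ↦ 1]`. -/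
def collapse (f f' : E) (ω : Config E) : Config E :=
  Function.update (Function.update ω f (ω f && ω f')) f' true

/-- The collapse at `f'`. -/
@[simp] lemma collapse_apply_snd (ω : Config E) : collapse f f' ω f' = true := by
  simp [collapse]

/-- The collapse at `f`. -/
lemma collapse_apply_fst (hff : f ≠ f') (ω : Config E) : collapse f f' ω f = (ω f && ω f') := by
  simp [collapse, Function.update_of_ne hff]

/-- The collapse off `{f, f'}`. -/
lemma collapse_apply_of_ne (ω : Config E) {e : E} (hef : e ≠ f) (hef' : e ≠ f') :
    collapse f f' ω e = ω e := by
  simp [collapse, Function.update_of_ne hef, Function.update_of_ne hef']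

/-- The collapse does not change the connections among the vertices other than `v`. -/
lemma conn_collapse_iff (hff : f ≠ f') (hf : ends f = s(v, w)) (hf' : ends f' = s(v, w'))
    (hdeg : ∀ e, v ∈ ends e → e = f ∨ e = f') (hvw : v ≠ w) (hvw' : v ≠ w') (ω : Config E)
    {x y : V} (hx : x ≠ v) (hy : y ≠ v) : Conn ends (collapse f f' ω) x y ↔ Conn ends ω x y :=
  conn_pair_iff hf hf' hdeg hvw hvw' (fun e h1 h2 => collapse_apply_of_ne ω h1 h2)
    (by rw [collapse_apply_fst hff, collapse_apply_snd, Bool.and_true]) hx hy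

/-- The cluster of `a₃ ≠ v` after the collapse agrees with the cluster before it off `v`. -/
lemma mem_cluster_collapse_of_ne (hff : f ≠ f') (hf : ends f = s(v, w)) (hf' : ends f' = s(v, w'))
    (hdeg : ∀ e, v ∈ ends e → e = f ∨ e = f') (hvw : v ≠ w) (hvw' : v ≠ w') (ω : Config E)
    {a₃ u : V} (h3 : a₃ ≠ v) (hu : u ≠ v) :
    u ∈ cluster ends (collapse f f' ω) a₃ ↔ u ∈ cluster ends ω a₃ := by
  simp only [mem_cluster]
  exact conn_collapse_iff hff hf hf' hdeg hvw hvw' ω h3 hu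

/-- After the collapse `v` is attached to `w'` by the sure edge `f'`: `v` lies in the cluster of
`a₃ ≠ v` iff `w'` lay in it before. -/
lemma mem_cluster_collapse_v (hff : f ≠ f') (hf : ends f = s(v, w)) (hf' : ends f' = s(v, w'))
    (hdeg : ∀ e, v ∈ ends e → e = f ∨ e = f') (hvw : v ≠ w) (hvw' : v ≠ w') (ω : Config E)
    {a₃ : V} (h3 : a₃ ≠ v) : v ∈ cluster ends (collapse f f' ω) a₃ ↔ w' ∈ cluster ends ω a₃ := by
  simp only [mem_cluster]
  have hc : Conn ends (collapse f f' ω) v w' := conn_of_openAdj ⟨f', collapse_apply_snd ω, hf'⟩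
  rw [← conn_collapse_iff hff hf hf' hdeg hvw hvw' ω h3 hvw'.symm]
  exact ⟨fun h => conn_trans h hc, fun h => conn_trans h (conn_symm hc)⟩

end Collapse

section Pushforward

variable {E : Type*} [Fintype E] [DecidableEq E] {R : Type*} [CommRing R] {f f' : E}

/-- **Pushforward.** The law `p[f ↦ p f · p f', f' ↦ 1]` is the image of the law `p` under the
collapse: `E_{p[f ↦ p f p f', f' ↦ 1]} G = E_p (G ∘ collapse f f')`. -/
theorem expect_collapse (p : E → R) (hff : f ≠ f') (G : Config E → R) :
    expect (Function.update (Function.update p f (p f * p f')) f' 1) G =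
      expect p (fun ω => G (collapse f f' ω)) := by
  have c1 : ∀ ω : Config E, collapse f f' (Function.update ω f' true) = Function.update ω f' true := by
    intro ω
    funext e
    by_cases he' : e = f'
    · rw [he']; simp [collapse]
    · by_cases he : e = f
      · rw [he]; simp [collapse, Function.update_of_ne hff]
      · simp [collapse, Function.update_of_ne he']
  have c0 : ∀ ω : Config E, collapse f f' (Function.update ω f' false) =
      Function.update (Function.update ω f false) f' true := by
    intro ω
    funext e
    by_cases he' : e = f'
    · rw [he']; simp [collapse]
    · by_cases he : e = f
      · rw [he]; simp [collapse, Function.update_of_ne hff]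
      · simp [collapse, Function.update_of_ne he, Function.update_of_ne he']
  have e1 : expect p (fun ω => G (Function.update ω f' true)) =
      p f * expect p (fun ω => G (Function.update (Function.update ω f true) f' true)) +
        (1 - p f) * expect p (fun ω => G (Function.update (Function.update ω f false) f' true)) := by
    rw [expect_eq_pin p (fun ω => G (Function.update ω f' true)) f, expect_update_one,
      expect_update_zero]
  have e2 : expect p (fun ω => G (collapse f f' ω)) =
      p f' * expect p (fun ω => G (Function.update ω f' true)) +
        (1 - p f') * expect p (fun ω => G (Function.update (Function.update ω f false) f' true)) := by
    rw [expect_eq_pin p (fun ω => G (collapse f f' ω)) f', expect_update_one, expect_update_zero]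
    simp only [c1, c0]
  have e3 : expect (Function.update (Function.update p f (p f * p f')) f' 1) G =
      (p f * p f') * expect p (fun ω => G (Function.update (Function.update ω f true) f' true)) +
        (1 - p f * p f') *
          expect p (fun ω => G (Function.update (Function.update ω f false) f' true)) := by
    rw [expect_update_one,
      expect_eq_pin (Function.update p f (p f * p f')) (fun ω => G (Function.update ω f' true)) f,
      Function.update_idem, Function.update_idem, Function.update_self, expect_update_one,
      expect_update_zero]
  rw [e3, e2, e1]
  ring

end Pushforward

section Prob

variable {E : Type*} [Fintype E] [DecidableEq E] {R : Type*} [Field R] {f f' : E}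

/-- **Pushforward for events**: `P_{p[f ↦ p f p f', f' ↦ 1]}(A) = P_p(collapse⁻¹ A)`. -/
theorem prob_collapse (p : E → R) (hff : f ≠ f') (A : Set (Config E)) :
    prob (Function.update (Function.update p f (p f * p f')) f' 1) A =
      prob p (collapse f f' ⁻¹' A) := by
  rw [prob_preimage_eq_expect, prob_eq_expect_indicator, expect_collapse p hff]

end Prob

section Events

variable {V : Type*} {E : Type*} [DecidableEq E] {ends : E → Sym2 V} {v w w' : V} {f f' : E}

/-- Marked connection events are collapse-invariant. -/
lemma preimage_connEvent_collapse (hff : f ≠ f') (hf : ends f = s(v, w)) (hf' : ends f' = s(v, w'))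
    (hdeg : ∀ e, v ∈ ends e → e = f ∨ e = f') (hvw : v ≠ w) (hvw' : v ≠ w') {x y : V} (hx : x ≠ v)
    (hy : y ≠ v) : collapse f f' ⁻¹' connEvent ends x y = connEvent ends x y := by
  ext ω
  simp only [Set.mem_preimage, mem_connEvent]
  exact conn_collapse_iff hff hf hf' hdeg hvw hvw' ω hx hy

/-- `Q = {a₁ ↮ a₂}` is collapse-invariant. -/
lemma preimage_avoidAll_collapse (hff : f ≠ f') (hf : ends f = s(v, w)) (hf' : ends f' = s(v, w'))
    (hdeg : ∀ e, v ∈ ends e → e = f ∨ e = f') (hvw : v ≠ w) (hvw' : v ≠ w') {a₁ a₂ : V}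
    (h1 : a₁ ≠ v) (h2 : a₂ ≠ v) :
    collapse f f' ⁻¹' avoidAll ends a₂ {a₁} = avoidAll ends a₂ {a₁} := by
  rw [avoidAll_eq_compl, Set.preimage_compl,
    preimage_connEvent_collapse hff hf hf' hdeg hvw hvw' h1 h2]

/-- `PD` is collapse-invariant. -/
lemma preimage_PDEvent_collapse (hff : f ≠ f') (hf : ends f = s(v, w)) (hf' : ends f' = s(v, w'))
    (hdeg : ∀ e, v ∈ ends e → e = f ∨ e = f') (hvw : v ≠ w) (hvw' : v ≠ w') {a₁ a₂ a₃ : V}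
    (h1 : a₁ ≠ v) (h2 : a₂ ≠ v) (h3 : a₃ ≠ v) :
    collapse f f' ⁻¹' PDEvent ends a₁ a₂ a₃ = PDEvent ends a₁ a₂ a₃ := by
  unfold PDEvent Dtilde UnionCluster.inU
  simp only [Set.preimage_inter, Set.preimage_compl, Set.preimage_union,
    preimage_connEvent_collapse hff hf hf' hdeg hvw hvw' h1 h2,
    preimage_connEvent_collapse hff hf hf' hdeg hvw hvw' h3 h1,
    preimage_connEvent_collapse hff hf hf' hdeg hvw hvw' h3 h2]

/-- `T` is collapse-invariant. -/
lemma preimage_TEvent_collapse (hff : f ≠ f') (hf : ends f = s(v, w)) (hf' : ends f' = s(v, w'))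
    (hdeg : ∀ e, v ∈ ends e → e = f ∨ e = f') (hvw : v ≠ w) (hvw' : v ≠ w') {a₁ a₂ a₃ : V}
    (h1 : a₁ ≠ v) (h2 : a₂ ≠ v) (h3 : a₃ ≠ v) :
    collapse f f' ⁻¹' TEvent ends a₁ a₂ a₃ = TEvent ends a₁ a₂ a₃ := by
  unfold TEvent
  simp only [Set.preimage_inter, Set.preimage_compl,
    preimage_connEvent_collapse hff hf hf' hdeg hvw hvw' h2 h1,
    preimage_connEvent_collapse hff hf hf' hdeg hvw hvw' h2 h3]

variable [Fintype V] [DecidableEq V]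

/-- **Residual connection events are collapse-invariant**: closing the edges touching `W` commutes
with the collapse up to the conjunction rule. -/
lemma preimage_connDelEvent_collapse (hff : f ≠ f') (hf : ends f = s(v, w))
    (hf' : ends f' = s(v, w')) (hdeg : ∀ e, v ∈ ends e → e = f ∨ e = f') (hvw : v ≠ w)
    (hvw' : v ≠ w') (W : Finset V) {x y : V} (hx : x ≠ v) (hy : y ≠ v) :
    collapse f f' ⁻¹' connDelEvent ends W x y = connDelEvent ends W x y := by
  ext ω
  simp only [Set.mem_preimage, mem_connDelEvent]
  refine conn_pair_iff hf hf' hdeg hvw hvw' ?_ ?_ hx hy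
  · intro e hef hef'
    simp only [restrict, collapse_apply_of_ne ω hef hef']
  · simp only [restrict, collapse_apply_fst hff, collapse_apply_snd]
    rcases Bool.eq_false_or_eq_true (ω f) with h | h <;>
      rcases Bool.eq_false_or_eq_true (ω f') with h' | h' <;> simp [h, h']

/-- The residual `Q` is collapse-invariant. -/
lemma preimage_delQ_collapse (hff : f ≠ f') (hf : ends f = s(v, w)) (hf' : ends f' = s(v, w'))
    (hdeg : ∀ e, v ∈ ends e → e = f ∨ e = f') (hvw : v ≠ w) (hvw' : v ≠ w') (W : Finset V)
    {a₁ a₂ : V} (h1 : a₁ ≠ v) (h2 : a₂ ≠ v) :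
    collapse f f' ⁻¹' delQ ends W a₁ a₂ = delQ ends W a₁ a₂ := by
  unfold delQ
  rw [Set.preimage_compl, preimage_connDelEvent_collapse hff hf hf' hdeg hvw hvw' W h1 h2]

omit [DecidableEq E] in
/-- **Adding `v` to a removed set containing one of its neighbours does not change the residual
connections** among the vertices other than `v`: `v` is then a leaf or isolated in `G ∖ W`. -/
lemma connDelEvent_insert_pair (hf : ends f = s(v, w)) (hf' : ends f' = s(v, w'))
    (hdeg : ∀ e, v ∈ ends e → e = f ∨ e = f') (hvw : v ≠ w) (hvw' : v ≠ w') {W : Finset V}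
    (hW : w ∈ W ∨ w' ∈ W) {x y : V} (hx : x ≠ v) (hy : y ≠ v) :
    connDelEvent ends (insert v W) x y = connDelEvent ends W x y := by
  ext ω
  simp only [mem_connDelEvent]
  refine conn_pair_iff hf hf' hdeg hvw hvw' ?_ ?_ hx hy
  · intro e hef hef'
    have key : e ∈ touches ends (↑(insert v W) : Set V) ↔ e ∈ touches ends (↑W : Set V) := by
      constructor
      · rintro ⟨z, hz, z', hz'⟩
        rw [Finset.coe_insert, Set.mem_insert_iff] at hz
        rcases hz with hzv | hz
        · have hev : v ∈ ends e := by rw [hz', hzv]; exact Sym2.mem_mk_left v z'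
          rcases hdeg e hev with h | h
          · exact absurd h hef
          · exact absurd h hef'
        · exact ⟨z, hz, z', hz'⟩
      · exact fun h => touches_mono (Finset.coe_subset.2 (Finset.subset_insert v W)) h
    by_cases hmem : e ∈ touches ends (↑W : Set V)
    · rw [restrict_apply_of_notMem (e := e) (by simpa using key.2 hmem),
        restrict_apply_of_notMem (e := e) (by simpa using hmem)]
    · rw [restrict_apply_of_mem (e := e) (by simpa using mt key.1 hmem),
        restrict_apply_of_mem (e := e) (by simpa using hmem)]
  · have hfT : f ∈ touches ends (↑(insert v W) : Set V) :=
      mem_touches_of_ends hf (Or.inl (by simp))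
    have hR : (restrict (touches ends ↑W)ᶜ ω f && restrict (touches ends ↑W)ᶜ ω f') = false := by
      rcases hW with hw | hw'
      · have h : f ∈ touches ends (↑W : Set V) := mem_touches_of_ends hf (Or.inr hw)
        rw [restrict_apply_of_notMem (e := f) (by simpa using h), Bool.false_and]
      · have h : f' ∈ touches ends (↑W : Set V) := mem_touches_of_ends hf' (Or.inr hw')
        rw [restrict_apply_of_notMem (e := f') (by simpa using h), Bool.and_false]
    rw [hR, restrict_apply_of_notMem (e := f) (by simpa using hfT), Bool.false_and]

omit [DecidableEq E] in
/-- The residual `Q` ignores an added `v` next to a removed neighbour. -/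
lemma delQ_insert_pair (hf : ends f = s(v, w)) (hf' : ends f' = s(v, w'))
    (hdeg : ∀ e, v ∈ ends e → e = f ∨ e = f') (hvw : v ≠ w) (hvw' : v ≠ w') {W : Finset V}
    (hW : w ∈ W ∨ w' ∈ W) {a₁ a₂ : V} (h1 : a₁ ≠ v) (h2 : a₂ ≠ v) :
    delQ ends (insert v W) a₁ a₂ = delQ ends W a₁ a₂ := by
  unfold delQ
  rw [connDelEvent_insert_pair hf hf' hdeg hvw hvw' hW h1 h2]

end Events

end SeriesCollapse

end Summit.Ventures.PercRepro2
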